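import Summits.FinalStateConjecture.FinalStateConjecture.Theorems.EIHFluxBalanceInertialRecessionRechartWhiteHoleAlgebra
import Mathlib.Topology.MetricSpace.Thickening
import Mathlib.Topology.UniformSpace.HeineCantor

/-!
# Route EIHFluxBalance — `InertialRecession`, re-charting: the uniform margin of the escape
# configuration (white-hole exclusion, analysis)

Helper file for the crux `stmt-FinalStateConjecture-10166`
(`Summit.FinalStateConjecture.FinalStateConjecture.Theses.EIHFluxBalance.InertialRecession`),
stub `stub_rechart` of line `sublinear-is-free-clean-window-charges`.

* `exists_uniform_margin` — a continuous function on an open neighbourhood of a compact set `K`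
  of a proper metric space varies by `< ε` within a uniform distance `δ` of `K` (compact
  `δ₀`-thickening inside the open set + Heine–Cantor).
* `exists_escape_margin` — for the frame-free painted radius
  `R(z, u) = √(η(z,u)² + η(z,z))` and painted Schwarzschild value
  `T(z, u) = η(W₀,W₀) + 2(M/R)(−η(W₀,u) + (η(z,W₀) + η(z,u)η(W₀,u))/R)²` of
  `…RechartWhiteHoleAlgebra`, along the frozen escape ray `z̃(s) = Λ_V(ζ(s), (r₀ + s/2)n̂)`,
  `u∞ = −Λ_V e₀`, `W₀ = Λ_V(1, ½n̂)`: uniformly in `s ∈ [0, L]`, every `(z, u)` within `δ` of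
  `(z̃(s), u∞)` has `|R − (r₀ + s/2)| < ε` and `T < −3/4 + M/(2r₀) + ε`.

[folklore analysis]
-/

noncomputable section

set_option linter.dupNamespace false

open scoped InnerProductSpace Topology
open Set Function Metric Literature.Geometry.Lorentzian

namespace Summit.FinalStateConjecture.FinalStateConjecture.Theorems

/-! ### A uniform margin around a compact set -/

/-- **Uniform margin.** If `f` is continuous on an open set `Ω ⊇ K`, `K` compact in a proper metric
space, then for every `ε > 0` there is `δ > 0` such that every point within distance `δ` of a
point `b ∈ K` lies in `Ω` and has `|f − f b| < ε` (a compact `δ₀`-thickening of `K` inside `Ω`,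
`IsCompact.exists_cthickening_subset_open`, and uniform continuity on it, Heine–Cantor).
[folklore] -/
theorem exists_uniform_margin {X : Type*} [PseudoMetricSpace X] [ProperSpace X] {K Ω : Set X}
    (hK : IsCompact K) (hΩ : IsOpen Ω) (hKΩ : K ⊆ Ω) {f : X → ℝ} (hf : ContinuousOn f Ω) {ε : ℝ}
    (hε : 0 < ε) :
    ∃ δ > 0, ∀ b ∈ K, ∀ p : X, dist p b ≤ δ → p ∈ Ω ∧ |f p - f b| < ε := by
  obtain ⟨δ₀, hδ₀, hsub⟩ := hK.exists_cthickening_subset_open hΩ hKΩ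
  have hK' : IsCompact (cthickening δ₀ K) := hK.cthickening
  have hunif := hK'.uniformContinuousOn_of_continuous (hf.mono hsub)
  obtain ⟨δ₁, hδ₁, hδ₁P⟩ := Metric.uniformContinuousOn_iff.mp hunif ε hε
  refine ⟨min δ₀ (δ₁ / 2), lt_min hδ₀ (by positivity), fun b hb p hp ↦ ?_⟩
  have hpK' : p ∈ cthickening δ₀ K :=
    mem_cthickening_of_dist_le p b δ₀ K hb (hp.trans (min_le_left _ _))
  have hbK' : b ∈ cthickening δ₀ K := self_subset_cthickening K hb
  refine ⟨hsub hpK', ?_⟩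
  have h := hδ₁P p hpK' b hbK' (lt_of_le_of_lt hp ((min_le_right _ _).trans_lt (by linarith)))
  rwa [Real.dist_eq] at h

/-- Registered one-line form (stub `uniform_margin_rechart` of the crux item) of
`exists_uniform_margin`. [folklore] -/
theorem uniform_margin_rechart : ∀ {X : Type*} [PseudoMetricSpace X] [ProperSpace X] {K Ω : Set X}, IsCompact K → IsOpen Ω → K ⊆ Ω → ∀ {f : X → ℝ}, ContinuousOn f Ω → ∀ {ε : ℝ}, 0 < ε → ∃ δ > 0, ∀ b ∈ K, ∀ p : X, dist p b ≤ δ → p ∈ Ω ∧ |f p - f b| < ε :=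
  fun hK hΩ hKΩ _ hf _ hε ↦ exists_uniform_margin hK hΩ hKΩ hf hε

/-! ### The margin of the escape configuration -/

/-- **Uniform margin of the escape configuration** (see the module docstring): the frame-free
painted radius `R` and painted Schwarzschild value `T` (given through their defining formulas
`hR`, `hT`) stay within `ε` of their frozen values `r₀ + s/2`, resp. below
`−3/4 + M/(2r₀) + ε`, at all `(z, u)` within `δ` of the frozen data `(z̃(s), u∞)`, uniformly in
`s ∈ [0, L]`. [folklore] -/
theorem exists_escape_margin {V : E3} (hV : ‖V‖ < 1) {n : E3} (hn : ‖n‖ = 1) {M r₀ : ℝ} (L : ℝ)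
    (hM : 0 ≤ M) (hr₀ : 0 < r₀) (ζ : ℝ → ℝ) (hζ : Continuous ζ) (W₀ : E4)
    (hW₀ : W₀ = Lorentz.boostCLM V (E4.ofTimeSpace 1 ((1 / 2 : ℝ) • n)))
    (R T : E4 × E4 → ℝ)
    (hR : ∀ p, R p = Real.sqrt (Minkowski.bilin p.1 p.2 ^ 2 + Minkowski.bilin p.1 p.1))
    (hT : ∀ p, T p = Minkowski.bilin W₀ W₀ + 2 * (M / R p) *
      (-Minkowski.bilin W₀ p.2 + (Minkowski.bilin p.1 W₀ + Minkowski.bilin p.1 p.2 *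
        Minkowski.bilin W₀ p.2) / R p) ^ 2)
    {ε : ℝ} (hε : 0 < ε) :
    ∃ δ > 0, ∀ s ∈ Icc 0 L, ∀ z u : E4,
      ‖z - Lorentz.boostCLM V (E4.ofTimeSpace (ζ s) ((r₀ + s / 2) • n))‖ ≤ δ →
      ‖u - -Lorentz.boostCLM V (E4.basisVector 0)‖ ≤ δ →
        |R (z, u) - (r₀ + s / 2)| < ε ∧ T (z, u) < -(3 / 4) + M / (2 * r₀) + ε := by
  -- the frozen data and its values
  set base : ℝ → E4 × E4 := fun s ↦
    (Lorentz.boostCLM V (E4.ofTimeSpace (ζ s) ((r₀ + s / 2) • n)),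
      -Lorentz.boostCLM V (E4.basisVector 0)) with hbase
  have hbasec : Continuous base := by
    refine Continuous.prodMk ?_ continuous_const
    refine (Lorentz.boostCLM V).continuous.comp ?_
    have h1 : Continuous fun s : ℝ ↦ (r₀ + s / 2) • n := by fun_prop
    have : (fun s ↦ E4.ofTimeSpace (ζ s) ((r₀ + s / 2) • n)) =
        fun s ↦ (ζ s) • E4.basisVector 0 + E4.ofTimeSpace 0 ((r₀ + s / 2) • n) :=
      funext fun s ↦ E4.ofTimeSpace_eq_smul_add _ _
    rw [this]
    exact (hζ.smul continuous_const).add ((E4.continuous_ofTimeSpace 0).comp h1)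
  have hQb : ∀ s, Minkowski.bilin (base s).1 (base s).2 ^ 2 + Minkowski.bilin (base s).1 (base s).1 =
      (r₀ + s / 2) ^ 2 := by
    intro s
    obtain ⟨-, -, hc, hd, -⟩ := frozen_values hV hn (ζ s) (r₀ + s / 2)
    show Minkowski.bilin (Lorentz.boostCLM V (E4.ofTimeSpace (ζ s) ((r₀ + s / 2) • n)))
        (-Lorentz.boostCLM V (E4.basisVector 0)) ^ 2 +
      Minkowski.bilin (Lorentz.boostCLM V (E4.ofTimeSpace (ζ s) ((r₀ + s / 2) • n)))
        (Lorentz.boostCLM V (E4.ofTimeSpace (ζ s) ((r₀ + s / 2) • n))) = _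
    rw [hc, hd]; ring
  have hval : ∀ s, 0 ≤ s → R (base s) = r₀ + s / 2 ∧
      T (base s) = -(3 / 4) + M / (2 * (r₀ + s / 2)) := by
    intro s hs
    have hρ : 0 < r₀ + s / 2 := by linarith
    obtain ⟨ha, hb, hc, -, he⟩ := frozen_values hV hn (ζ s) (r₀ + s / 2)
    rw [← hW₀] at ha hb he
    have hRb : R (base s) = r₀ + s / 2 := by
      rw [hR, hQb, Real.sqrt_sq hρ.le]
    refine ⟨hRb, ?_⟩
    rw [hT, hRb]
    show Minkowski.bilin W₀ W₀ + 2 * (M / (r₀ + s / 2)) *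
      (-Minkowski.bilin W₀ (-Lorentz.boostCLM V (E4.basisVector 0)) +
        (Minkowski.bilin (Lorentz.boostCLM V (E4.ofTimeSpace (ζ s) ((r₀ + s / 2) • n))) W₀ +
          Minkowski.bilin (Lorentz.boostCLM V (E4.ofTimeSpace (ζ s) ((r₀ + s / 2) • n)))
            (-Lorentz.boostCLM V (E4.basisVector 0)) *
          Minkowski.bilin W₀ (-Lorentz.boostCLM V (E4.basisVector 0))) / (r₀ + s / 2)) ^ 2 = _
    rw [ha, hb, hc, he]
    field_simp
    ring
  -- the open set where the radicand is large
  set Q : E4 × E4 → ℝ := fun p ↦ Minkowski.bilin p.1 p.2 ^ 2 + Minkowski.bilin p.1 p.1 with hQ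
  have hQc : Continuous Q := by
    have h12 : Continuous fun p : E4 × E4 ↦ Minkowski.bilin p.1 p.2 :=
      Minkowski.bilin.continuous₂
    have h11 : Continuous fun p : E4 × E4 ↦ Minkowski.bilin p.1 p.1 :=
      Minkowski.bilin.continuous₂.comp (continuous_fst.prodMk continuous_fst)
    exact (h12.pow 2).add h11
  set Ω : Set (E4 × E4) := {p | (r₀ / 2) ^ 2 < Q p} with hΩ
  have hΩo : IsOpen Ω := isOpen_lt continuous_const hQc
  have hRΩ : ∀ p ∈ Ω, r₀ / 2 < R p := fun p hp ↦ by
    rw [hR p]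
    calc r₀ / 2 = Real.sqrt ((r₀ / 2) ^ 2) := (Real.sqrt_sq (by linarith)).symm
      _ < Real.sqrt (Q p) := Real.sqrt_lt_sqrt (sq_nonneg _) hp
  have hRc : ContinuousOn R Ω := by
    have : R = fun p ↦ Real.sqrt (Q p) := funext fun p ↦ hR p
    rw [this]
    exact (Real.continuous_sqrt.comp hQc).continuousOn
  have hTc : ContinuousOn T Ω := by
    have hR0 : ∀ p ∈ Ω, R p ≠ 0 := fun p hp ↦ by linarith [hRΩ p hp]
    have h2 : Continuous fun p : E4 × E4 ↦ Minkowski.bilin W₀ p.2 :=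
      (Minkowski.bilin W₀).continuous.comp continuous_snd
    have h1W : Continuous fun p : E4 × E4 ↦ Minkowski.bilin p.1 W₀ :=
      Minkowski.bilin.continuous₂.comp (continuous_fst.prodMk continuous_const)
    have h12 : Continuous fun p : E4 × E4 ↦ Minkowski.bilin p.1 p.2 :=
      Minkowski.bilin.continuous₂
    have hTeq : T = fun p ↦ Minkowski.bilin W₀ W₀ + 2 * (M / R p) *
        (-Minkowski.bilin W₀ p.2 + (Minkowski.bilin p.1 W₀ + Minkowski.bilin p.1 p.2 *
          Minkowski.bilin W₀ p.2) / R p) ^ 2 := funext fun p ↦ hT p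
    rw [hTeq]
    refine continuousOn_const.add ((continuousOn_const.mul (continuousOn_const.div hRc hR0)).mul
      ((h2.continuousOn.neg.add (((h1W.add (h12.mul h2)).continuousOn).div hRc hR0)).pow 2))
  -- the compact base set lies in `Ω`
  set K : Set (E4 × E4) := base '' Icc 0 L with hK
  have hKc : IsCompact K := isCompact_Icc.image hbasec
  have hKΩ : K ⊆ Ω := by
    rintro _ ⟨s, hs, rfl⟩
    show (r₀ / 2) ^ 2 < Q (base s)
    have : Q (base s) = (r₀ + s / 2) ^ 2 := hQb s
    rw [this]
    nlinarith [hs.1]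
  -- margins for `R` and `T`
  obtain ⟨δR, hδR, hPR⟩ := exists_uniform_margin hKc hΩo hKΩ hRc hε
  obtain ⟨δT, hδT, hPT⟩ := exists_uniform_margin hKc hΩo hKΩ hTc hε
  refine ⟨min δR δT, lt_min hδR hδT, fun s hs z u hz hu ↦ ?_⟩
  have hb : base s ∈ K := ⟨s, hs, rfl⟩
  have hdist : dist (z, u) (base s) ≤ min δR δT := by
    rw [Prod.dist_eq, dist_eq_norm, dist_eq_norm]
    exact max_le hz hu
  obtain ⟨-, h1⟩ := hPR _ hb (z, u) (hdist.trans (min_le_left _ _))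
  obtain ⟨-, h2⟩ := hPT _ hb (z, u) (hdist.trans (min_le_right _ _))
  obtain ⟨hv1, hv2⟩ := hval s hs.1
  rw [hv1] at h1
  rw [hv2] at h2
  refine ⟨h1, ?_⟩
  have h3 : M / (2 * (r₀ + s / 2)) ≤ M / (2 * r₀) :=
    div_le_div_of_nonneg_left hM (by linarith) (by linarith [hs.1])
  have h4 := (abs_lt.mp h2).2
  linarith

end Summit.FinalStateConjecture.FinalStateConjecture.Theorems
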